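import Summits.ABC.StewartYu.PadicG3SchedB
import Summits.ABC.StewartYu.PadicG3ParVO
import HarnessLib

/-!
# Cell abc-stewartyu, crux `Y07Odd` (stmt-ABC-19658), `m ≥ 1` branch: schedule arithmetic of the record schedule `P.sched1b b`
# for the inequality stub `stub_ineqs1` (PART A, file 1 — twin of p3-g7's `PadicG3VbSched` for the v1 family)

`Summits/ABC/StewartYu/PadicG3OneSched.lean` — cell `abc-stewartyu` (seat p1-g8; split ACKed by the route holder
STATUS 2026-08-27T05:41:03Z: p1 = sched1 PART A, p5 = generic glue + PART B).  Theorems only, no named fact.  For the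
`m ≥ 1` record schedule `Sc := P.sched1b b` (`PadicG3SchedB`; fields `Xs, T, Mord, L₀, H, Sdepth` of the v1 family
`PadicG3Par`, box scale `L/b`, `b ≥ 1`) the sizes every family of the inequality pack needs, in p1's v1 currency:
* orders: `T` antitone, `Mord s ν ≤ Mord 0 0`, `Mord s n = M/(n+2)³ + (n+2)·T s`, `M/(n+2)³ ≤ (16/27)(n+1)L`,
  `TordS Sc lev ν ≤ TordS Sc 0 0 ≤ (83/5)(n+1)L` (exact-form `T01_le_mul` of `PadicG3ParVO`), and the half-step order budget
  `TordS Sc lev n − tS Sc lev ≤ M/(n+2)³ + (n+1)(T lev + Ŝ) ≤ (43/5)(n+1)L`;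
* box (`b ≥ 1`): `sideS₂ Sc j ≤ L/(2Aⱼ)`, `Lb (sideS₂ Sc) lev j ≤ L/(2^lev Aⱼ)`, `Σⱼ Lb·Aⱼ ≤ n L/2^lev`, `Σⱼ Lb ≤ n L/2^lev` (`Aⱼ ≥ 1`);
* nodes: `NS Sc lev ν = 2^ν Xs lev ≤ 2^ν 2^lev X/2`, `NhS Sc lev = Xs lev`, `tS Sc lev = T lev + 1 ≤ 8L + 1`.

WHAT THIS IS NOT: the Z-currency sizes of p2's closed forms (file 2 `PadicG3OneSizes`) or the family lines (file 3).

References: Yu. V. Nesterenko, LNM 1819 (2003) (4.3)–(4.5); K. Yu, Acta Math. 211 (2013) §3.1.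
-/

noncomputable section

open Finset
open Literature.NumberTheory.Transcendental

namespace Summit.ABC.StewartYu

namespace PadicG3Par

variable {n : ℕ} (P : PadicG3Par n)

/-- `T` is antitone in the level. [cite: Nesterenko2003, (4.3)] -/
theorem T_mono {s s' : ℕ} (h : s ≤ s') : P.T s' ≤ P.T s := by
  unfold T
  exact Nat.div_le_div_left (Nat.pow_le_pow_right (by norm_num) h) (by positivity)

/-- `Mord s ν ≤ Mord 0 0` (orders only decrease along the schedule). [cite: Nesterenko2003, (4.5)] -/
theorem Mord_le_zero_zero (s ν : ℕ) : P.Mord s ν ≤ P.Mord 0 0 := by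
  unfold Mord
  have h1 : P.T s ≤ P.T 0 := P.T_mono (Nat.zero_le _)
  have h2 : 2 * (n + 1) - ν ≤ 2 * (n + 1) - 0 := Nat.sub_le_sub_left (Nat.zero_le _) _
  gcongr

/-- `Mord s n = M/(n+2)³ + T s · (n+2)`. [cite: Nesterenko2003, (4.5)] -/
theorem Mord_at_n (s : ℕ) : P.Mord s n = P.M / (n + 2) ^ 3 + P.T s * (n + 2) := by
  unfold Mord
  rw [show 2 * (n + 1) - n = n + 2 by omega]

/-- `M/(n+2)³ ≤ 16(n+1)L/(n+2)³` (real). [folklore] -/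
theorem M_div_real_le : ((P.M / (n + 2) ^ 3 : ℕ) : ℝ) ≤ 16 * (n + 1) * P.L / (n + 2) ^ 3 := by
  have h2 : ((P.M / (n + 2) ^ 3 : ℕ) : ℝ) ≤ ((P.M : ℕ) : ℝ) / (((n + 2) ^ 3 : ℕ) : ℝ) := Nat.cast_div_le
  push_cast at h2
  rw [P.M_real] at h2
  exact h2

/-- `M/(n+2)³ ≤ (16/27)(n+1)L` (real, `(n+2)³ ≥ 27`). [folklore] -/
theorem M_div_real_le' : ((P.M / (n + 2) ^ 3 : ℕ) : ℝ) ≤ (16 / 27) * (n + 1) * P.L := by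
  have h := P.M_div_real_le
  have hn : (1 : ℝ) ≤ n := by exact_mod_cast P.hn
  have hL : (0 : ℝ) ≤ P.L := by positivity
  have h3 : (3 : ℝ) ≤ (n : ℝ) + 2 := by linarith
  have h27 : (27 : ℝ) ≤ ((n : ℝ) + 2) ^ 3 := by
    calc (27 : ℝ) = 3 ^ 3 := by norm_num
      _ ≤ ((n : ℝ) + 2) ^ 3 := pow_le_pow_left₀ (by norm_num) h3 3
  have hnum : (0 : ℝ) ≤ 16 * (n + 1) * P.L := by positivity
  calc ((P.M / (n + 2) ^ 3 : ℕ) : ℝ) ≤ 16 * (n + 1) * P.L / (n + 2) ^ 3 := h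
    _ ≤ 16 * (n + 1) * P.L / 27 := div_le_div_of_nonneg_left hnum (by norm_num) h27
    _ = (16 / 27) * (n + 1) * P.L := by ring

/-- `(n+1)(Ŝ + 3) ≤ (n+1)L/2^21` (real; the depth is negligible against `L`). [folklore] -/
theorem succ_mul_Sdepth_real_le : ((n : ℝ) + 1) * (P.Sdepth + 3) ≤ (n + 1) * P.L / 2 ^ 21 := by
  have h4 : ((2 ^ 21 * (P.Sdepth + 3) : ℕ) : ℝ) ≤ P.L := by exact_mod_cast P.two_pow_21_mul_Sdepth_le_L
  push_cast at h4
  rw [le_div_iff₀ (by positivity)]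
  have hn : (0 : ℝ) ≤ (n : ℝ) + 1 := by positivity
  nlinarith [mul_le_mul_of_nonneg_left h4 hn]

/-- **The START order**: `Mord 0 0 + Ŝ(n+1) + n ≤ (83/5)(n+1)L` (real; `16(1 + 1/27 + 2^{−25}) < 16.6`). [cite: Nesterenko2003, (4.6)] -/
theorem startOrders1_real_le : (P.Mord 0 0 : ℝ) + P.Sdepth * (n + 1) + n ≤ (83 / 5) * (n + 1) * P.L := by
  have h := P.T01_le_mul
  have hn : (1 : ℝ) ≤ n := by exact_mod_cast P.hn
  have hL : (0 : ℝ) ≤ P.L := by positivity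
  have hS : (0 : ℝ) ≤ P.Sdepth := by positivity
  have h3 : (3 : ℝ) ≤ (n : ℝ) + 2 := by linarith
  have h27' : (27 : ℝ) ≤ ((n : ℝ) + 2) ^ 3 := by
    calc (27 : ℝ) = 3 ^ 3 := by norm_num
      _ ≤ ((n : ℝ) + 2) ^ 3 := pow_le_pow_left₀ (by norm_num) h3 3
  have h27 : (1 : ℝ) / (n + 2) ^ 3 ≤ 1 / 27 := by
    apply div_le_div_of_nonneg_left (by norm_num) (by norm_num) h27' 
  have hmain : 16 * (n + 1) * (P.L : ℝ) * (1 + 1 / (n + 2) ^ 3 + 1 / 2 ^ 25) ≤ (83 / 5) * (n + 1) * P.L := by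
    have hpos : (0 : ℝ) ≤ 16 * (n + 1) * P.L := by positivity
    have : (1 : ℝ) + 1 / (n + 2) ^ 3 + 1 / 2 ^ 25 ≤ 83 / 80 := by
      have : (1 : ℝ) / 2 ^ 25 ≤ 1 / 10000 := by norm_num
      linarith
    calc 16 * (n + 1) * (P.L : ℝ) * (1 + 1 / (n + 2) ^ 3 + 1 / 2 ^ 25) ≤ 16 * (n + 1) * P.L * (83 / 80) :=
          mul_le_mul_of_nonneg_left this hpos
      _ = (83 / 5) * (n + 1) * P.L := by ring
  nlinarith

/-- **The half-step order budget** (real): `M/(n+2)³ + (n+1)(T lev + Ŝ) ≤ (43/5)(n+1)L` (`T lev ≤ 8L`, `Ŝ ≤ L/2^21`). [folklore] -/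
theorem halfOrders1_real_le (lev : ℕ) :
    ((P.M / (n + 2) ^ 3 + (n + 1) * (P.T lev + P.Sdepth) : ℕ) : ℝ) ≤ (43 / 5) * (n + 1) * P.L := by
  have h1 := P.M_div_real_le'
  have h2 : ((P.T lev : ℕ) : ℝ) ≤ 8 * P.L := by exact_mod_cast P.T_le lev
  have h3 := P.succ_mul_Sdepth_real_le
  push_cast
  have hn : (0 : ℝ) ≤ (n : ℝ) + 1 := by positivity
  have hL : (0 : ℝ) ≤ P.L := by positivity
  have h4 : ((n : ℝ) + 1) * P.L / 2 ^ 21 ≤ (n + 1) * P.L / 100 := by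
    apply div_le_div_of_nonneg_left (by positivity) (by norm_num) (by norm_num)
  nlinarith [mul_le_mul_of_nonneg_left h2 hn]

/-- `T lev + 1 ≤ 8L + 1` (real). [folklore] -/
theorem T_succ_real_le (lev : ℕ) : (P.T lev : ℝ) + 1 ≤ 8 * P.L + 1 := by
  have h2 : ((P.T lev : ℕ) : ℝ) ≤ 8 * P.L := by exact_mod_cast P.T_le lev
  linarith

end PadicG3Par

namespace G3Setup

variable {p : ℕ} [Fact p.Prime] (S : G3Setup p) (P : PadicG3Par S.n) (b : ℝ)

/-! ### The schedule `P.sched1b b` through p2's derived quantities -/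

/-- `NS (sched1b b) lev ν = 2^ν · Xs lev`. [folklore] -/
theorem NS_1b (lev ν : ℕ) : S.NS (P.sched1b b) lev ν = 2 ^ ν * P.Xs lev := rfl

/-- `NhS (sched1b b) lev = Xs lev`. [folklore] -/
theorem NhS_1b (lev : ℕ) : S.NhS (P.sched1b b) lev = P.Xs lev := rfl

/-- `tS (sched1b b) lev = T lev + 1`. [folklore] -/
theorem tS_1b (lev : ℕ) : S.tS (P.sched1b b) lev = P.T lev + 1 := rfl

/-- `TordS (sched1b b) lev ν = Mord lev ν + (Ŝ − lev)(n+1) + (n − ν)`. [folklore] -/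
theorem TordS_1b (lev ν : ℕ) : S.TordS (P.sched1b b) lev ν = P.Mord lev ν + ((P.Sdepth - lev) * (S.n + 1) + (S.n - ν)) := rfl

/-- `NS (sched1b b) lev ν ≤ 2^ν · 2^lev X/2` (real). [cite: Nesterenko2003, (4.24)] -/
theorem NS_1b_real_le (lev ν : ℕ) : (S.NS (P.sched1b b) lev ν : ℝ) ≤ 2 ^ ν * (2 ^ lev * P.X / 2) := by
  rw [S.NS_1b P b]
  push_cast
  exact mul_le_mul_of_nonneg_left (P.Xs_le lev) (by positivity)

/-- `NhS (sched1b b) lev ≤ 2^lev X/2` (real). [cite: Nesterenko2003, (4.24)] -/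
theorem NhS_1b_real_le (lev : ℕ) : (S.NhS (P.sched1b b) lev : ℝ) ≤ 2 ^ lev * P.X / 2 := by
  rw [S.NhS_1b P b]; exact P.Xs_le lev

/-- `tS (sched1b b) lev ≤ 8L + 1` (real). [folklore] -/
theorem tS_1b_real_le (lev : ℕ) : (S.tS (P.sched1b b) lev : ℝ) ≤ 8 * P.L + 1 := by
  rw [S.tS_1b P b]; push_cast; exact P.T_succ_real_le lev

/-- **`TordS lev ν ≤ TordS 0 0`** along the schedule. [folklore] -/
theorem TordS_1b_le_zero (lev ν : ℕ) : S.TordS (P.sched1b b) lev ν ≤ S.TordS (P.sched1b b) 0 0 := by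
  rw [S.TordS_1b P b, S.TordS_1b P b]
  have h1 := P.Mord_le_zero_zero lev ν
  have h2 : (P.Sdepth - lev) * (S.n + 1) ≤ (P.Sdepth - 0) * (S.n + 1) := Nat.mul_le_mul_right _ (Nat.sub_le_sub_left (Nat.zero_le _) _)
  have h3 : S.n - ν ≤ S.n - 0 := Nat.sub_le_sub_left (Nat.zero_le _) _
  omega

/-- **`TordS 0 0 ≤ (83/5)(n+1)·L`** (real). [cite: Nesterenko2003, (4.6)] -/
theorem TordS_1b_zero_real_le : (S.TordS (P.sched1b b) 0 0 : ℝ) ≤ (83 / 5) * (S.n + 1) * P.L := by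
  rw [S.TordS_1b P b]
  have h := P.startOrders1_real_le
  simp only [Nat.sub_zero]
  push_cast
  nlinarith [h]

/-- `TordS lev ν ≤ (83/5)(n+1)·L` (real), every state. [folklore] -/
theorem TordS_1b_real_le (lev ν : ℕ) : (S.TordS (P.sched1b b) lev ν : ℝ) ≤ (83 / 5) * (S.n + 1) * P.L :=
  le_trans (by exact_mod_cast S.TordS_1b_le_zero P b lev ν) (S.TordS_1b_zero_real_le P b)

/-- **The half-step order budget**: `TordS lev n − tS lev ≤ M/(n+2)³ + (n+1)(T lev + Ŝ)`. [folklore] -/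
theorem TordS_1b_half_sub_le (lev : ℕ) :
    S.TordS (P.sched1b b) lev S.n - S.tS (P.sched1b b) lev ≤ P.M / (S.n + 2) ^ 3 + (S.n + 1) * (P.T lev + P.Sdepth) := by
  rw [S.TordS_1b P b, S.tS_1b P b, P.Mord_at_n]
  simp only [Nat.sub_self, add_zero]
  have h2 : (P.Sdepth - lev) * (S.n + 1) ≤ (S.n + 1) * P.Sdepth := by rw [mul_comm]; exact Nat.mul_le_mul_left _ (Nat.sub_le _ _)
  have e : (S.n + 1) * (P.T lev + P.Sdepth) = P.T lev * (S.n + 2) - P.T lev + (S.n + 1) * P.Sdepth := by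
    have : P.T lev * (S.n + 2) = P.T lev * (S.n + 1) + P.T lev := by ring
    rw [this, Nat.add_sub_cancel]; ring
  apply tsub_le_iff_right.mpr
  have : P.T lev * (S.n + 2) = P.T lev * (S.n + 1) + P.T lev := by ring
  nlinarith [h2, this]

/-- The half-step order budget, real: `≤ (43/5)(n+1)·L`. [folklore] -/
theorem TordS_1b_half_sub_real_le (lev : ℕ) :
    ((S.TordS (P.sched1b b) lev S.n - S.tS (P.sched1b b) lev : ℕ) : ℝ) ≤ (43 / 5) * (S.n + 1) * P.L :=
  le_trans (by exact_mod_cast S.TordS_1b_half_sub_le P b lev) (P.halfOrders1_real_le lev)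

/-! ### The box -/

/-- `sideS₂ (sched1b b) j ≤ L/(2 Aⱼ)` for `b ≥ 1`. [folklore] -/
theorem sideS₂_1b_le (hb : 1 ≤ b) (j : Fin S.n) : (S.sideS₂ (P.sched1b b) j : ℝ) ≤ P.L / (2 * P.A j) := by
  unfold sideS₂
  rw [P.sched1b_Lbox, P.sched1b_A]
  have hA := P.A_pos j
  have hL : (0 : ℝ) ≤ P.L := by positivity
  refine (Nat.floor_le (by positivity)).trans ?_
  rw [div_div]
  exact div_le_div_of_nonneg_left hL (by positivity) (by nlinarith)

/-- **`Lb (sideS₂ (sched1b b)) lev j ≤ L/(2^lev Aⱼ)`** for `b ≥ 1`. [folklore] -/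
theorem Lb_1b_le (hb : 1 ≤ b) (lev : ℕ) (j : Fin S.n) :
    (S.Lb (S.sideS₂ (P.sched1b b)) lev j : ℝ) ≤ P.L / (2 ^ lev * P.A j) := by
  have h1 := S.Lb_le_real (S.sideS₂ (P.sched1b b)) lev j
  have h2 := S.sideS₂_1b_le P b hb j
  have hA := P.A_pos j
  have h2' : 2 * (S.sideS₂ (P.sched1b b) j : ℝ) / (2 : ℝ) ^ lev ≤ 2 * (P.L / (2 * P.A j)) / (2 : ℝ) ^ lev := by
    gcongr
  refine h1.trans (h2'.trans (le_of_eq ?_))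
  field_simp

/-- `Σⱼ Lb·Aⱼ ≤ n·L/2^lev`. [folklore] -/
theorem sum_Lb_mul_A_1b_le (hb : 1 ≤ b) (lev : ℕ) :
    ∑ j, (S.Lb (S.sideS₂ (P.sched1b b)) lev j : ℝ) * P.A j ≤ S.n * P.L / 2 ^ lev := by
  have h : ∀ j ∈ (Finset.univ : Finset (Fin S.n)), (S.Lb (S.sideS₂ (P.sched1b b)) lev j : ℝ) * P.A j ≤ P.L / 2 ^ lev := by
    intro j _
    have h1 := S.Lb_1b_le P b hb lev j
    have hA := P.A_pos j
    calc (S.Lb (S.sideS₂ (P.sched1b b)) lev j : ℝ) * P.A j ≤ P.L / (2 ^ lev * P.A j) * P.A j :=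
          mul_le_mul_of_nonneg_right h1 hA.le
      _ = P.L / 2 ^ lev := by field_simp
  calc ∑ j, (S.Lb (S.sideS₂ (P.sched1b b)) lev j : ℝ) * P.A j ≤ ∑ _j : Fin S.n, (P.L : ℝ) / 2 ^ lev := Finset.sum_le_sum h
    _ = S.n * P.L / 2 ^ lev := by rw [Finset.sum_const, Finset.card_univ, Fintype.card_fin, nsmul_eq_mul]; ring

/-- `Σⱼ Lb ≤ n·L/2^lev` when every `Aⱼ ≥ 1`. [folklore] -/
theorem sum_Lb_1b_le (hb : 1 ≤ b) (hA1 : ∀ j, 1 ≤ P.A j) (lev : ℕ) :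
    ∑ j, (S.Lb (S.sideS₂ (P.sched1b b)) lev j : ℝ) ≤ S.n * P.L / 2 ^ lev := by
  refine le_trans (Finset.sum_le_sum fun j _ => ?_) (S.sum_Lb_mul_A_1b_le P b hb lev)
  have h0 : (0 : ℝ) ≤ (S.Lb (S.sideS₂ (P.sched1b b)) lev j : ℝ) := by positivity
  nlinarith [hA1 j]

/-- `Σⱼ Lb ≤ n·L` when every `Aⱼ ≥ 1` (level-free form). [folklore] -/
theorem sum_Lb_1b_le' (hb : 1 ≤ b) (hA1 : ∀ j, 1 ≤ P.A j) (lev : ℕ) :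
    ∑ j, (S.Lb (S.sideS₂ (P.sched1b b)) lev j : ℝ) ≤ S.n * P.L := by
  refine (S.sum_Lb_1b_le P b hb hA1 lev).trans ?_
  have h1 : (1 : ℝ) ≤ 2 ^ lev := one_le_pow₀ (by norm_num)
  have h0 : (0 : ℝ) ≤ S.n * P.L := by positivity
  exact div_le_self h0 h1

end G3Setup

end Summit.ABC.StewartYu

end
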